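import Mathlib
import Literature.MathematicalPhysics.QuantumFieldTheory.Balaban1983to89.B2Prop31ZeroField

/-!
# `Balaban1983to89.B2Prop31ZeroFieldModel` — [Balaban1982Higgs2] Proposition 3.1 p. 589, ZERO-FIELD CLAUSE, on a
# CONCRETE multiscale model: the inputs (3.27) `⟨Φ, Δ(0)Φ⟩ ≧ ⟨Φ, Δ′(0)Φ⟩` and (3.28) `⟨Φ, Δ′(0)Φ⟩ = Σ_k ⟨φ_k,
# Δ^{(k),Lᵏε}(Bᵏ(Λ_k), 0)φ_k⟩`, which `B2Prop31ZeroField.ZMulti` carries as instance data, PROVED for the variational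
# Schur complements of the exponent (3.23) at `Ã^ε = 0` on arbitrary disjoint annuli `Bᵏ(Λ_k) ⊂ εℤ^d` and an
# arbitrary outer piece — so the cell's typed `B2.Prop31Printed P` is INHABITED on a concrete family with NO
# instance hypotheses (`prop31Printed_zeroField_model`); theorems + carrier defs

statement-level skeleton of published theorems with citation tags; proofs where landed; nothing here is a claim about the Yang–Mills mass gap

PDF held: `paper:balaban1982-cmp86-higgs23-ii` (journal page = PDF page + 554); pp. 588–590 READ AS IMAGES on the ×2
renders `…/1982-cmp86-higgs23-II-p034-x2.png` … `-p036-x2.png`.  Unit `lit-balaban-r14` gen 5 (reader/typer B1–B2, second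
reader of B2; fold owner r02, §3 verifier r13, referee ref-4), HOME `run/shared/lean/pub/lit-balaban/`.  SKELETON rows
**B2.Prop3.1** (decl of record `B2.Prop31Printed`) and **B2.Eq3.29** ((3.27)–(3.29)); sequel of `B2Prop31ZeroField`
(p251183: (3.29)₀ `formZ_ge`, (3.26)₀ `ZMulti.sum326_le_form` modulo the instance data `h327`/`h328`).

THE SOURCE TEXT (verbatim, pp. 588–590; the full Proposition 3.1 is quoted in `B2Prop31ZeroField`).  (3.23) p. 588:
*"∫dφ₀↾_{Λ₅⁽⁰⁾} exp[−½Σ_{k=1}^{K} a_k(Lᵏε)^{d−2} Σ_{x_k∈Λ₅⁽ᵏ⁻¹⁾′∩Λ₅⁽ᵏ⁾ᶜ} |φ_k(x_k) − (Q_k(Ã^ε)φ₀)(x_k)|² − ½⟨φ₀, (−Δ^ε_{Ã^ε} +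
m²)φ₀⟩], (3.23) where Λ₅⁽ᴷ⁾ = ∅."*; (3.24)–(3.25) p. 588–589: *"Φ = Λ₅⁽⁰⁾ᶜφ₀ + Σ_{k=1}^{K}(Λ₅⁽ᵏ⁻¹⁾′∩Λ₅⁽ᵏ⁾ᶜ)φ_k, (3.24) …
(3.23) = Z(Ã^ε)exp(−½⟨Φ, Δ(Ã^ε)Φ⟩). (3.25)"*; proof of Proposition 3.1, p. 589: *"We estimate the integral (3.23) by a
similar integral with the covariant derivatives −½ε^d|(D^ε_{Ã^ε}φ₀)(b)|² replaced by 0 for all the bonds b connecting the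
set Bᵏ(Λ₅⁽ᵏ⁾ᶜ) with Bᵏ(Λ₅⁽ᵏ⁾) for some k = 0, 1, …, K − 1. This inequality holds for an arbitrary configuration Φ. If we
denote the integral on the right side of the obtained inequality by Z′(Ã^ε)exp(−½⟨Φ, Δ′(Ã^ε)Φ⟩), then we have ⟨Φ, Δ(Ã^ε)Φ⟩
≧ ⟨Φ, Δ′(Ã^ε)Φ⟩, (3.27) because the inequality for the integrals holds for all Φ. Thus we have separated the expressions in
the corresponding sets by Neumann boundary conditions. … The form ⟨Φ, Δ′(Ã^ε)Φ⟩ is given by the formula ⟨Φ, Δ′(Ã^ε)Φ⟩ =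
Σ_{k=0}^{K} ⟨φ_k, Δ^{(k),Lᵏε}(Bᵏ(Λ₅⁽ᵏ⁻¹⁾′∩Λ₅⁽ᵏ⁾ᶜ), Ã^ε)φ_k⟩. (3.28) The term for k = 0 already has the form required by the
right side of (3.26) … Let us rescale the kᵗʰ term from the Lᵏε-lattice to the 1-lattice, φ_k(x) = (Lᵏε)^{−(d−2)/2}
φ′_k((Lᵏε)⁻¹x), and let us denote for simplicity Λ_k = (Λ₅⁽ᵏ⁻¹⁾′∩Λ₅⁽ᵏ⁾ᶜ)₁."*  Part I (1.3)/(1.5): `⟨φ, (−Δ^{ε,N}_Ω)φ⟩ =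
Σ_{b⊂Ω} ε^{d−2}|φ(b₊) − φ(b₋)|²`, `Σ_x ε^d|φ(x)|²`; (2.10): `Q_k` = the block mean.

THE MODEL (lattice units of the b04 lineage; `Ã^ε = 0`, so `U ≡ 1` and everything is componentwise in the `N` real
components).  Fine lattice = `ℤ^{d+1}` in units of the spacing `ε` (paper's dimension `d` ↤ our `d + 1`).  A
multiscale zero-field instance (`CMulti`) is: `ε > 0`, `K` with `Lᴷε ≦ 1`; for `k = 1, …, K` a unit-lattice annulus
`Λ_k` (finite) whose fine piece is `Bᵏ(Λ_k) = B4Lower18.fineDom (L^k) Λ_k ⊂ ℤ^{d+1}` (blocks of `L^k` fine points per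
direction) carrying the INTEGRATED part of `φ₀` and the block field `φ_k : Λ_k → ℝ^N` of Φ; an OUTER finite set `S₀ ⊂
ℤ^{d+1}` (↤ `Λ₅⁽⁰⁾ᶜ`) carrying the part `φ₀↾_{Λ₅⁽⁰⁾ᶜ}` of Φ (`φout`); the pieces pairwise disjoint (fields `hdisj₀`,
`hdisj`).  The exponent of (3.23) (× (−2)) as a function of the inner field `h = φ₀↾_{⋃Bᵏ(Λ_k)}`:
`qFull h = Σ_k [a_k(Lᵏε)^{d−2}Σ_{x∈Λ_k}|φ_k(x) − (Q_k h)(x)|² + Σ_{b⊂Bᵏ(Λ_k)} ε^{d−2}|h(b₊) − h(b₋)|² + Σ ε^d m²|h|²]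
 + [the same kinetic + mass sums of φout on S₀] + Σ_{bonds b joining two different pieces} ε^{d−2}|φ₀(b₊) − φ₀(b₋)|²`
(`qDec` = the first two brackets = the exponent *"with the covariant derivatives … replaced by 0 for all the bonds b
connecting"* different pieces; `cross` = the last sum).  **`⟨Φ, Δ(0)Φ⟩ := inf_h qFull h`** and **`⟨Φ, Δ′(0)Φ⟩ := inf_h
qDec h`** — the VARIATIONAL meaning of the Schur complements of (3.25)/(3.27) (for these Gaussian integrals `−2·log` of
the integral is the infimum of the exponent up to the constant `log Z`; the Gaussian route of the printed reason for
(3.27) is p15's `B2Sect3BSchurStep.form_le_of_gaussian_le`, not repeated here).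

WHAT IS PROVED (kernel, no `sorry`, axioms standard).  §1 on the b04 carriers: `energyR` (= `a_k‖ψ − Q_kg‖² + ⟨g, (−Δ^{η,N}
+ m²)g⟩`, the constrained fine energy of `B4Prop31Zero`), **`energyR_eq_KeffR_add`** (completing the square: `energyR ψ g =
⟨ψ, Δ⁽ᵏ⁾(Bᵏ(Λ),0)ψ⟩ + N⁻¹⟨g − g⋆, T(g − g⋆)⟩`, `g⋆ = B4Prop31Zero.gStarR`), `KeffR_le_energyR` / `energyR_gStarR` (the Schur
complement IS the minimum over the fine field).  §2 `annulusQ` (the kᵗʰ physical term of (3.23) at zero field, one real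
component) and **`annulusQ_eq`** (= `(Lᵏε)^{d−2}·energyR` with mass `m²(Lᵏε)²` — the rescaling sentence p. 590 for the
whole term, from `B4Prop31Zero.fineEnergyR_eq` and `ε = Lᵏε/L^k`), `annulusQ_ge` / `annulusQ_gStar`.  §3 `CMulti`,
`qDec`, `cross`, `qFull`, `form`, `formN`, `value`; `cross_nonneg`, **`formN_le_form`** (= (3.27)₀: `inf qDec ≦ inf qFull`),
**`formN_eq_value`** (= (3.28)₀ with every term identified: `inf_h qDec h = bond0 + mass0 + Σ_{k=1}^{K} formZ (L^k) a_k
(m²(Lᵏε)²) Λ_k φ′_k`, `φ′_k = rescale (Lᵏε) φ_k`, the infimum ATTAINED at the assembled minimisers `hStar`).  §4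
`toZMulti` (the instance data of `B2Prop31ZeroField.ZMulti` DISCHARGED), `concreteFam P`, **`sum326_le_form_model`**
((3.26)₀ for every concrete instance) and **`prop31Printed_zeroField_model : B2.Prop31Printed P (concreteFam P d m²)`**.
HONEST SCOPE.  (i) `Ã = 0` only.  (ii) The Schur complements are taken in the variational sense (infimum of the
exponent), equal to the Gaussian one of (3.25) up to the standard identity for Gaussian integrals with positive definite
inner block (p15's (3.25) `B2Sect3BSchurStep.eq325` in matrix coordinates); that identity is not re-proved here.  (iii)
The inner domain is exactly `⋃_k Bᵏ(Λ_k)` (no extra inner sites without a block term; such sites would add a decoupled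
nonnegative term with infimum 0); the geometry of the Λ₅⁽ʲ⁾ themselves (big blocks, primes, r(Lʲε)-separations) is not
modelled — any finite annuli and outer set are allowed, which is MORE than the paper's configurations.  (iv) Constants
as in `B2Prop31ZeroField` (`γ₀ = min(a(1 − L⁻²)/(8d + 2m²), 1/8)`).  Value = the zero-field clause of a published
proposition kernel-checked on a concrete family; NOT summit progress.
-/

noncomputable section

namespace Literature.MathematicalPhysics.QuantumFieldTheory.Balaban1983to89.B2Prop31ZeroFieldModel

open Finset Matrix
open Literature.MathematicalPhysics.QuantumFieldTheory.Balaban1983to89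
open Literature.MathematicalPhysics.QuantumFieldTheory.Balaban1983to89.B4Reflection242 (nbrs)
open Literature.MathematicalPhysics.QuantumFieldTheory.Balaban1983to89.B4Lower18
open Literature.MathematicalPhysics.QuantumFieldTheory.Balaban1983to89.B4Prop31Zero
open Literature.MathematicalPhysics.QuantumFieldTheory.Balaban1983to89.B2Prop31ZeroField

variable {d : ℕ}

/-! ## §1  The constrained fine energy of the b04 lineage: the Schur complement is its minimum -/

/-- **THE CONSTRAINED FINE ENERGY** `E(g, ψ) = a_k‖ψ − Q_kg‖² + N⁻¹(⟨g, Tg⟩ − (a_k/N)‖indR g‖²)` (`N = n^{d+1}`, `T =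
B4Lower18.fineOpR`, `Q_k = N⁻¹·indR`; by `B4Prop31Zero.fineEnergyR_eq` the bracket is the kinetic + mass energy of `g`) —
in the paper's variables `a_k‖φ_k − Q_kφ₀‖² + ⟨φ₀, (−Δ^{η,N}_{Bᵏ(Λ)} + m²)φ₀⟩`, the exponent of (3.23) restricted to one
annulus on the 1-lattice. [cite: Balaban1982Higgs2, (3.23) p.588 / (3.29) p.590, dictionary at Ã = 0] -/
def energyR (n : ℕ) (a m2 : ℝ) (Ω : Finset (Fin (d + 1) → ℤ)) (ψ : ↥Ω → ℝ) (g : ↥(fineDom n Ω) → ℝ) : ℝ :=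
  a * (∑ y, (ψ y - ((n : ℝ) ^ (d + 1))⁻¹ * (indR n Ω).mulVec g y) ^ 2)
    + ((n : ℝ) ^ (d + 1))⁻¹ * (g ⬝ᵥ (fineOpR n a m2 (fineDom n Ω)).mulVec g
        - a * ((n : ℝ) ^ (d + 1))⁻¹ * ∑ y, (indR n Ω).mulVec g y ^ 2)

/-- adjointness across the dot product for a symmetric matrix. [folklore] -/
private theorem dot_mulVec_symm {ι : Type*} [Fintype ι] {M : Matrix ι ι ℝ} (hM : M.IsSymm) (x y : ι → ℝ) :
    x ⬝ᵥ M.mulVec y = M.mulVec x ⬝ᵥ y := by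
  rw [Matrix.dotProduct_mulVec, ← Matrix.mulVec_transpose, hM.eq]

/-- **COMPLETING THE SQUARE**: `E(g, ψ) = ⟨ψ, Δ⁽ᵏ⁾(Bᵏ(Λ), 0)ψ⟩ + N⁻¹⟨g − g⋆, T(g − g⋆)⟩` with `g⋆ = a_kG_k indRᵀψ`
(`B4Prop31Zero.gStarR`). [cite: Balaban1982Higgs2, (3.25)/(3.27) p.589 (variational Schur complement), dictionary] -/
theorem energyR_eq_KeffR_add {n : ℕ} (hn : 1 ≤ n) {a m2 : ℝ} (ha : 0 < a) (hm : 0 ≤ m2)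
    (Ω : Finset (Fin (d + 1) → ℤ)) (ψ : ↥Ω → ℝ) (g : ↥(fineDom n Ω) → ℝ) :
    energyR n a m2 Ω ψ g
      = ψ ⬝ᵥ (KeffR n a m2 Ω).mulVec ψ
        + ((n : ℝ) ^ (d + 1))⁻¹ *
          ((g - gStarR n a m2 Ω ψ) ⬝ᵥ (fineOpR n a m2 (fineDom n Ω)).mulVec (g - gStarR n a m2 Ω ψ)) := by
  unfold energyR
  rw [energy_expandR, KeffR_form_eq]
  set T := fineOpR n a m2 (fineDom n Ω)
  set G := (fineOpR n a m2 (fineDom n Ω))⁻¹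
  set φ := (indR n Ω)ᵀ.mulVec ψ
  set w := gStarR n a m2 Ω ψ
  have hw : w = a • G.mulVec φ := rfl
  have hTG : T.mulVec (G.mulVec φ) = φ := by
    rw [Matrix.mulVec_mulVec, fineOpR_mul_inv_fineDom hn ha hm Ω, Matrix.one_mulVec]
  have hTw : T.mulVec w = a • φ := by rw [hw, Matrix.mulVec_smul, hTG]
  have hsymm : T.IsSymm := fineOpR_isSymm n a m2 (fineDom n Ω)
  have h1 : g ⬝ᵥ T.mulVec w = a * (φ ⬝ᵥ g) := by
    rw [hTw, dotProduct_smul, smul_eq_mul, dotProduct_comm]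
  have h2 : w ⬝ᵥ T.mulVec g = a * (φ ⬝ᵥ g) := by
    rw [dot_mulVec_symm hsymm, hTw, smul_dotProduct, smul_eq_mul]
  have h3 : w ⬝ᵥ T.mulVec w = a ^ 2 * (φ ⬝ᵥ G.mulVec φ) := by
    rw [hTw, dotProduct_smul, smul_eq_mul, hw, smul_dotProduct, smul_eq_mul, dotProduct_comm]
    ring
  have key : (g - w) ⬝ᵥ T.mulVec (g - w)
      = g ⬝ᵥ T.mulVec g - 2 * a * (φ ⬝ᵥ g) + a ^ 2 * (φ ⬝ᵥ G.mulVec φ) := by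
    rw [Matrix.mulVec_sub, dotProduct_sub, sub_dotProduct, sub_dotProduct, h1, h2, h3]
    ring
  rw [key]
  ring

/-- **THE SCHUR COMPLEMENT IS THE MINIMUM**: `⟨ψ, Δ⁽ᵏ⁾(Bᵏ(Λ), 0)ψ⟩ ≦ E(g, ψ)` for every fine field `g` (`T ≧ (min(2,a_k) +
m²)·1 > 0`, `B4Lower18.lower18`). [cite: Balaban1982Higgs2, (3.25)/(3.27) p.589 (variational Schur complement), dictionary] -/
theorem KeffR_le_energyR {n : ℕ} (hn : 1 ≤ n) {a m2 : ℝ} (ha : 0 < a) (hm : 0 ≤ m2)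
    (Ω : Finset (Fin (d + 1) → ℤ)) (ψ : ↥Ω → ℝ) (g : ↥(fineDom n Ω) → ℝ) :
    ψ ⬝ᵥ (KeffR n a m2 Ω).mulVec ψ ≤ energyR n a m2 Ω ψ g := by
  rw [energyR_eq_KeffR_add hn ha hm]
  set u := g - gStarR n a m2 Ω ψ
  have hpos : 0 ≤ u ⬝ᵥ (fineOpR n a m2 (fineDom n Ω)).mulVec u := by
    have h := lower18 hn ha.le m2 (fineDom_isBlockUnion hn Ω) u
    have h0 : 0 ≤ (min 2 a + m2) * (u ⬝ᵥ u) :=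
      mul_nonneg (add_pos_of_pos_of_nonneg (lt_min two_pos ha) hm).le
        (Finset.sum_nonneg fun x _ => mul_self_nonneg (u x))
    exact h0.trans h
  have : 0 ≤ ((n : ℝ) ^ (d + 1))⁻¹ * (u ⬝ᵥ (fineOpR n a m2 (fineDom n Ω)).mulVec u) :=
    mul_nonneg (by positivity) hpos
  linarith

/-- … and is attained at `g⋆` (`B4Prop31Zero.KeffR_form_eq_energy`). [cite: Balaban1982Higgs2, (3.25) p.589, dictionary] -/
theorem energyR_gStarR {n : ℕ} (hn : 1 ≤ n) {a m2 : ℝ} (ha : 0 < a) (hm : 0 ≤ m2)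
    (Ω : Finset (Fin (d + 1) → ℤ)) (ψ : ↥Ω → ℝ) :
    energyR n a m2 Ω ψ (gStarR n a m2 Ω ψ) = ψ ⬝ᵥ (KeffR n a m2 Ω).mulVec ψ :=
  (KeffR_form_eq_energy hn ha hm Ω ψ).symm

/-! ## §2  The kᵗʰ term of (3.23) at zero field in physical units, and the rescaling sentence -/

/-- **THE kᵗʰ TERM OF THE EXPONENT (3.23) AT `Ã^ε = 0`** (one real component, × 2, as a function of the integrated fine
field `h = φ₀↾_{Bᵏ(Λ_k)}` and the block field `ψ = φ_k`, PHYSICAL units: spacing `eps`, `s = Lᵏ·eps`, `n = L^k`):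
`a_k s^{d−2}Σ_{x∈Λ_k}|ψ(x) − (Q_k h)(x)|² + Σ_{b⊂Bᵏ(Λ_k)} eps^{d−2}|h(b₊) − h(b₋)|² + Σ_{x} eps^d m²|h(x)|²` (`Q_k` = block
mean; each nearest-neighbour bond once = `½ΣΣ_{x′∼x}`; Neumann: both endpoints in `Bᵏ(Λ_k)`).
[cite: Balaban1982Higgs2, (3.23) p.588 with I (1.3)/(1.5)/(2.10), dictionary at Ã = 0] -/
def annulusQ (n : ℕ) (ak m2 s eps : ℝ) (Λ : Finset (Fin (d + 1) → ℤ)) (ψ : ↥Λ → ℝ)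
    (h : ↥(fineDom n Λ) → ℝ) : ℝ :=
  ak * s ^ (((d + 1 : ℕ) : ℝ) - 2) * (∑ y, (ψ y - ((n : ℝ) ^ (d + 1))⁻¹ * (indR n Λ).mulVec h y) ^ 2)
    + eps ^ (((d + 1 : ℕ) : ℝ) - 2) *
        ((1 / 2 : ℝ) * ∑ x : ↥(fineDom n Λ), ∑ x' : ↥(fineDom n Λ),
          if x'.1 ∈ nbrs x.1 then (h x - h x') ^ 2 else 0)
    + eps ^ (d + 1) * (m2 * (h ⬝ᵥ h))

/-- scale bookkeeping: with `eps = s/n`, `s^{d−2}·n^{−(d+1)}·n² = eps^{d−2}` (real powers; paper's `d` = our `d+1`).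
[folklore] -/
private theorem scale_kin {n : ℕ} (hn : 1 ≤ n) {s : ℝ} (hs : 0 < s) :
    s ^ (((d + 1 : ℕ) : ℝ) - 2) * (((n : ℝ) ^ (d + 1))⁻¹ * ((n : ℝ) ^ 2 / 2))
      = (s / n) ^ (((d + 1 : ℕ) : ℝ) - 2) * (1 / 2 : ℝ) := by
  have hn0 : (0 : ℝ) < n := by exact_mod_cast hn
  rw [Real.div_rpow hs.le hn0.le]
  have hnD : ((n : ℝ) ^ (d + 1)) = (n : ℝ) ^ (((d + 1 : ℕ) : ℝ)) := by
    rw [Real.rpow_natCast]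
  have hn2 : ((n : ℝ) ^ 2) = (n : ℝ) ^ ((2 : ℕ) : ℝ) := by rw [Real.rpow_natCast]
  have hsplit : (n : ℝ) ^ (((d + 1 : ℕ) : ℝ) - 2) = (n : ℝ) ^ (((d + 1 : ℕ) : ℝ)) / (n : ℝ) ^ ((2 : ℕ) : ℝ) := by
    rw [← Real.rpow_sub hn0]
    norm_num
  rw [hsplit, hnD, hn2]
  have hpos1 : (0 : ℝ) < (n : ℝ) ^ (((d + 1 : ℕ) : ℝ)) := Real.rpow_pos_of_pos hn0 _
  have hpos2 : (0 : ℝ) < (n : ℝ) ^ (((2 : ℕ) : ℝ)) := Real.rpow_pos_of_pos hn0 _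
  field_simp

/-- scale bookkeeping, mass part: `s^{d−2}·n^{−(d+1)}·(m²s²) = eps^{d+1}·m²`. [folklore] -/
private theorem scale_mass {n : ℕ} (hn : 1 ≤ n) {s : ℝ} (hs : 0 < s) (m2 : ℝ) :
    s ^ (((d + 1 : ℕ) : ℝ) - 2) * (((n : ℝ) ^ (d + 1))⁻¹ * (m2 * s ^ 2))
      = (s / n) ^ (d + 1) * m2 := by
  have hn0 : (0 : ℝ) < n := by exact_mod_cast hn
  have hpow : s ^ (((d + 1 : ℕ) : ℝ) - 2) * s ^ 2 = s ^ (d + 1) := by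
    rw [← Real.rpow_natCast s 2, ← Real.rpow_add hs, ← Real.rpow_natCast s (d + 1)]
    congr 1
    push_cast
    ring
  have hne : ((n : ℝ) ^ (d + 1)) ≠ 0 := pow_ne_zero _ hn0.ne'
  calc s ^ (((d + 1 : ℕ) : ℝ) - 2) * (((n : ℝ) ^ (d + 1))⁻¹ * (m2 * s ^ 2))
      = (s ^ (((d + 1 : ℕ) : ℝ) - 2) * s ^ 2) * ((n : ℝ) ^ (d + 1))⁻¹ * m2 := by ring
    _ = (s / n) ^ (d + 1) * m2 := by rw [hpow, div_pow]; field_simp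

/-- **THE RESCALING SENTENCE FOR THE WHOLE kᵗʰ TERM** (*"Let us rescale the kᵗʰ term from the Lᵏε-lattice to the
1-lattice"*): with `eps = s/n` (i.e. `ε = Lᵏε/L^k`), `annulusQ = s^{d−2} · energyR` with the 1-lattice mass `m²s²` — so the
physical term in `(φ₀, φ_k)` is the b04 constrained energy in `(φ₀, φ_k)` up to the factor `(Lᵏε)^{d−2}`, which is exactly
the square of the rescaling `φ ↦ (Lᵏε)^{(d−2)/2}φ` of both fields. [cite: Balaban1982Higgs2, p.590 (rescaling), (3.23) p.588] -/
theorem annulusQ_eq {n : ℕ} (hn : 1 ≤ n) (ak m2 : ℝ) {s eps : ℝ} (hs : 0 < s) (heps : eps = s / n)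
    (Λ : Finset (Fin (d + 1) → ℤ)) (ψ : ↥Λ → ℝ) (h : ↥(fineDom n Λ) → ℝ) :
    annulusQ n ak m2 s eps Λ ψ h = s ^ (((d + 1 : ℕ) : ℝ) - 2) * energyR n ak (m2 * s ^ 2) Λ ψ h := by
  unfold annulusQ energyR
  rw [fineEnergyR_eq hn ak (m2 * s ^ 2) Λ h, heps]
  have hk := scale_kin (d := d) hn hs
  have hm := scale_mass (d := d) hn hs m2
  set S1 := ∑ y, (ψ y - ((n : ℝ) ^ (d + 1))⁻¹ * (indR n Λ).mulVec h y) ^ 2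
  set S2 := ∑ x : ↥(fineDom n Λ), ∑ x' : ↥(fineDom n Λ), if x'.1 ∈ nbrs x.1 then (h x - h x') ^ 2 else 0
  set c := s ^ (((d + 1 : ℕ) : ℝ) - 2)
  set N := ((n : ℝ) ^ (d + 1))⁻¹
  calc ak * c * S1 + (s / n) ^ (((d + 1 : ℕ) : ℝ) - 2) * ((1 / 2 : ℝ) * S2) + (s / n) ^ (d + 1) * (m2 * (h ⬝ᵥ h))
      = ak * c * S1 + (c * (N * ((n : ℝ) ^ 2 / 2))) * S2 + (c * (N * (m2 * s ^ 2))) * (h ⬝ᵥ h) := by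
        rw [hk, hm]; ring
    _ = c * (ak * S1 + N * ((n : ℝ) ^ 2 / 2 * S2 + m2 * s ^ 2 * (h ⬝ᵥ h))) := by ring

/-- **THE kᵗʰ TERM DOMINATES ITS SCHUR VALUE**: `annulusQ ψ h ≧ (Lᵏε)^{d−2}·⟨ψ, Δ⁽ᵏ⁾(Bᵏ(Λ_k),0)ψ⟩ = ⟨φ′_k, Δ⁽ᵏ⁾φ′_k⟩`
for every fine field `h`. [cite: Balaban1982Higgs2, (3.27)–(3.28) p.589, dictionary at Ã = 0] -/
theorem annulusQ_ge {n : ℕ} (hn : 1 ≤ n) {ak m2 : ℝ} (hak : 0 < ak) (hm : 0 ≤ m2) {s eps : ℝ} (hs : 0 < s)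
    (heps : eps = s / n) (Λ : Finset (Fin (d + 1) → ℤ)) (ψ : ↥Λ → ℝ) (h : ↥(fineDom n Λ) → ℝ) :
    s ^ (((d + 1 : ℕ) : ℝ) - 2) * (ψ ⬝ᵥ (KeffR n ak (m2 * s ^ 2) Λ).mulVec ψ) ≤ annulusQ n ak m2 s eps Λ ψ h := by
  rw [annulusQ_eq hn ak m2 hs heps]
  exact mul_le_mul_of_nonneg_left (KeffR_le_energyR hn hak (by positivity) Λ ψ h) (Real.rpow_nonneg hs.le _)

/-- … with equality at the minimiser `g⋆`. [cite: Balaban1982Higgs2, (3.28) p.589, dictionary at Ã = 0] -/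
theorem annulusQ_gStar {n : ℕ} (hn : 1 ≤ n) {ak m2 : ℝ} (hak : 0 < ak) (hm : 0 ≤ m2) {s eps : ℝ} (hs : 0 < s)
    (heps : eps = s / n) (Λ : Finset (Fin (d + 1) → ℤ)) (ψ : ↥Λ → ℝ) :
    annulusQ n ak m2 s eps Λ ψ (gStarR n ak (m2 * s ^ 2) Λ ψ)
      = s ^ (((d + 1 : ℕ) : ℝ) - 2) * (ψ ⬝ᵥ (KeffR n ak (m2 * s ^ 2) Λ).mulVec ψ) := by
  rw [annulusQ_eq hn ak m2 hs heps, energyR_gStarR hn hak (by positivity)]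

/-- the square of the rescaling factor. [folklore] -/
private theorem rescaleFactor_sq' {s : ℝ} (hs : 0 < s) :
    (s ^ ((((d + 1 : ℕ) : ℝ) - 2) / 2)) ^ 2 = s ^ (((d + 1 : ℕ) : ℝ) - 2) := by
  rw [← Real.rpow_natCast (s ^ ((((d + 1 : ℕ) : ℝ) - 2) / 2)) 2, ← Real.rpow_mul hs.le]
  congr 1
  push_cast
  ring

/-- the 1-lattice form of the rescaled block field: `formZ (rescale s φ) = s^{d−2}·formZ φ`.
[cite: Balaban1982Higgs2, p.590 (rescaling), dictionary] -/
theorem formZ_rescale {s : ℝ} (hs : 0 < s) (n : ℕ) (ak μ : ℝ) (Λ : Finset (Fin (d + 1) → ℤ)) {N : ℕ}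
    (φ : ↥Λ → Fin N → ℝ) :
    formZ n ak μ Λ (rescale s φ) = s ^ (((d + 1 : ℕ) : ℝ) - 2) * formZ n ak μ Λ φ := by
  unfold formZ
  rw [Finset.mul_sum]
  refine Finset.sum_congr rfl fun c _ => ?_
  have hfun : (fun y => rescale s φ y c) = (s ^ ((((d + 1 : ℕ) : ℝ) - 2) / 2)) • (fun y => φ y c) := by
    funext y; simp [rescale]
  rw [hfun, Matrix.mulVec_smul, smul_dotProduct, dotProduct_smul, smul_eq_mul, smul_eq_mul, ← mul_assoc, ← sq,
    rescaleFactor_sq' hs]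

/-! ## §3  The concrete multiscale zero-field model -/

/-- **A CONCRETE MULTISCALE ZERO-FIELD INSTANCE** (model constants `d, L, a, m²` outside): the spacing `ε > 0`, `K` with
`Lᴷε ≦ 1`, the annuli `Λ_k` (k = 1 … K) with their block fields `φ_k : Λ_k → ℝ^N` (physical), the outer finite set
`S₀ ⊂ ℤ^{d+1}` (↤ `Λ₅⁽⁰⁾ᶜ`, fine-lattice units) with the outer field `φout = φ₀↾_{S₀}`, and the DISJOINTNESS of the pieces
`S₀`, `Bᵏ(Λ_k) = fineDom (L^k) Λ_k` (recorded; the theorems below do not even need it).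
[cite: Balaban1982Higgs2, (3.23)–(3.24) p.588, dictionary at Ã^ε = 0] -/
structure CMulti (d L : ℕ) (a m2 : ℝ) where
  -- lattice spacing
  ε : ℝ
  hε : 0 < ε
  -- number of steps, `Lᴷε ≦ 1`
  K : ℕ
  hK : (L : ℝ) ^ K * ε ≤ 1
  -- annuli and block fields
  Λ : ℕ → Finset (Fin (d + 1) → ℤ)
  N : ℕ
  φ : (k : ℕ) → ↥(Λ k) → Fin N → ℝ
  -- the outer piece and the outer field
  S₀ : Finset (Fin (d + 1) → ℤ)
  φout : ↥S₀ → Fin N → ℝ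
  -- disjointness of the pieces (not used by the theorems)
  hdisj₀ : ∀ k, 1 ≤ k → k ≤ K → Disjoint S₀ (fineDom (L ^ k) (Λ k))
  hdisj : ∀ k k', 1 ≤ k → k < k' → k' ≤ K → Disjoint (fineDom (L ^ k) (Λ k)) (fineDom (L ^ k') (Λ k'))

namespace CMulti

variable {L : ℕ} {a m2 : ℝ}

/-- `s_k = Lᵏε`. [cite: Balaban1982Higgs2, (3.26) p.589, dictionary] -/
def s (i : CMulti d L a m2) (k : ℕ) : ℝ := (L : ℝ) ^ k * i.ε

/-- the type of the INTEGRATED fine field `h = φ₀↾_{⋃_k Bᵏ(Λ_k)}` (per annulus, per component).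
[cite: Balaban1982Higgs2, (3.23) p.588 «∫dφ₀↾_{Λ₅⁽⁰⁾}», dictionary] -/
abbrev Inner (i : CMulti d L a m2) : Type := (k : ℕ) → ↥(fineDom (L ^ k) (i.Λ k)) → Fin i.N → ℝ

/-- the k = 0 bond sum `Σ_{⟨x,x′⟩⊂Λ₅⁽⁰⁾ᶜ} ε^{d−2}|φ₀(x′) − φ₀(x)|²` (each bond once). [cite: Balaban1982Higgs2, (3.26) p.589 (k = 0 term), dictionary] -/
def bond0 (i : CMulti d L a m2) : ℝ :=
  i.ε ^ (((d + 1 : ℕ) : ℝ) - 2) *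
    ∑ c : Fin i.N, ((1 / 2 : ℝ) * ∑ x : ↥i.S₀, ∑ x' : ↥i.S₀,
      if x'.1 ∈ nbrs x.1 then (i.φout x c - i.φout x' c) ^ 2 else 0)

/-- the k = 0 mass sum `Σ_{x∈Λ₅⁽⁰⁾ᶜ} ε^d m²|φ₀(x)|²`. [cite: Balaban1982Higgs2, (3.26) p.589 (k = 0 term), dictionary] -/
def mass0 (i : CMulti d L a m2) : ℝ :=
  i.ε ^ (d + 1) * ∑ c : Fin i.N, m2 * ((fun x => i.φout x c) ⬝ᵥ (fun x => i.φout x c))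

/-- **THE DECOUPLED EXPONENT** (× (−2)): (3.23) at zero field *"with the covariant derivatives … replaced by 0 for all the
bonds b connecting"* different pieces — the outer kinetic + mass sums plus the annulus terms.
[cite: Balaban1982Higgs2, (3.27)–(3.28) p.589, dictionary at Ã^ε = 0] -/
def qDec (i : CMulti d L a m2) (h : i.Inner) : ℝ :=
  i.bond0 + i.mass0 + ∑ k ∈ Icc 1 i.K, ∑ c : Fin i.N,
    annulusQ (L ^ k) (B1.aSeq a L k) m2 (i.s k) i.ε (i.Λ k) (fun y => i.φ k y c) (fun x => h k x c)

/-- **THE CROSS TERMS**: `Σ ε^{d−2}|φ₀(b₊) − φ₀(b₋)|²` over the nearest-neighbour bonds joining two different pieces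
(outer–annulus, and annulus–annulus with k < k′), each once. [cite: Balaban1982Higgs2, p.589 «the bonds b connecting the set Bᵏ(Λ₅⁽ᵏ⁾ᶜ) with Bᵏ(Λ₅⁽ᵏ⁾)», dictionary] -/
def cross (i : CMulti d L a m2) (h : i.Inner) : ℝ :=
  i.ε ^ (((d + 1 : ℕ) : ℝ) - 2) *
    ((∑ k ∈ Icc 1 i.K, ∑ c : Fin i.N, ∑ x : ↥(fineDom (L ^ k) (i.Λ k)), ∑ y : ↥i.S₀,
        if y.1 ∈ nbrs x.1 then (h k x c - i.φout y c) ^ 2 else 0)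
      + ∑ k ∈ Icc 1 i.K, ∑ k' ∈ (Icc 1 i.K).filter (fun k' => k < k'), ∑ c : Fin i.N,
          ∑ x : ↥(fineDom (L ^ k) (i.Λ k)), ∑ x' : ↥(fineDom (L ^ k') (i.Λ k')),
            if x'.1 ∈ nbrs x.1 then (h k x c - h k' x' c) ^ 2 else 0)

/-- **THE FULL EXPONENT** (× (−2)) of (3.23) at zero field as a function of the integrated field: decoupled part +
cross terms. [cite: Balaban1982Higgs2, (3.23)/(3.25) pp.588–589, dictionary at Ã^ε = 0] -/
def qFull (i : CMulti d L a m2) (h : i.Inner) : ℝ := i.qDec h + i.cross h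

/-- **`⟨Φ, Δ(0)Φ⟩`** := the infimum of the full exponent over the integrated field (variational Schur complement of
(3.25)). [cite: Balaban1982Higgs2, (3.25) p.589, dictionary (variational)] -/
def form (i : CMulti d L a m2) : ℝ := ⨅ h : i.Inner, i.qFull h

/-- **`⟨Φ, Δ′(0)Φ⟩`** := the infimum of the decoupled exponent. [cite: Balaban1982Higgs2, (3.27) p.589, dictionary (variational)] -/
def formN (i : CMulti d L a m2) : ℝ := ⨅ h : i.Inner, i.qDec h

/-- the right side of (3.28) at zero field: `bond0 + mass0 + Σ_{k=1}^{K} ⟨φ′_k, Δ⁽ᵏ⁾(Bᵏ(Λ_k), 0)φ′_k⟩`,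
`φ′_k = rescale (Lᵏε) φ_k`. [cite: Balaban1982Higgs2, (3.28) p.589, dictionary at Ã^ε = 0] -/
def value (i : CMulti d L a m2) : ℝ :=
  i.bond0 + i.mass0 + ∑ k ∈ Icc 1 i.K,
    formZ (L ^ k) (B1.aSeq a L k) (m2 * ((L : ℝ) ^ k * i.ε) ^ 2) (i.Λ k) (rescale ((L : ℝ) ^ k * i.ε) (i.φ k))

/-- the assembled minimiser: on the annulus k, component c, the b04 minimiser `g⋆` for `φ_k,c`.
[cite: Balaban1982Higgs2, (3.28) p.589, dictionary] -/
def hStar (i : CMulti d L a m2) : i.Inner :=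
  fun k x c => gStarR (L ^ k) (B1.aSeq a L k) (m2 * i.s k ^ 2) (i.Λ k) (fun y => i.φ k y c) x

/-- the cross terms are nonnegative. [folklore] -/
private theorem cross_nonneg (i : CMulti d L a m2) (h : i.Inner) : 0 ≤ i.cross h := by
  unfold cross
  refine mul_nonneg (Real.rpow_nonneg i.hε.le _) (add_nonneg ?_ ?_)
  · refine Finset.sum_nonneg fun k _ => Finset.sum_nonneg fun c _ => Finset.sum_nonneg fun x _ =>
      Finset.sum_nonneg fun y _ => ?_
    split_ifs <;> positivity
  · refine Finset.sum_nonneg fun k _ => Finset.sum_nonneg fun k' _ => Finset.sum_nonneg fun c _ =>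
      Finset.sum_nonneg fun x _ => Finset.sum_nonneg fun x' _ => ?_
    split_ifs <;> positivity

/-- `qDec ≦ qFull` pointwise (*"This inequality holds for an arbitrary configuration Φ"* — dropping squares).
[cite: Balaban1982Higgs2, (3.27) p.589] -/
theorem qDec_le_qFull (i : CMulti d L a m2) (h : i.Inner) : i.qDec h ≤ i.qFull h := by
  unfold qFull
  linarith [i.cross_nonneg h]

/-- `0 < s_k`. [folklore] -/
private theorem s_pos (i : CMulti d L a m2) (hL : 1 < L) (k : ℕ) : 0 < i.s k := by
  unfold s
  have : (0 : ℝ) < (L : ℝ) := by exact_mod_cast (by omega : 0 < L)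
  exact mul_pos (pow_pos this k) i.hε

/-- `ε = s_k / L^k`. [folklore] -/
private theorem s_div (i : CMulti d L a m2) (hL : 1 < L) (k : ℕ) : i.ε = i.s k / ((L ^ k : ℕ) : ℝ) := by
  unfold s
  have : (0 : ℝ) < (L : ℝ) := by exact_mod_cast (by omega : 0 < L)
  push_cast
  field_simp

/-- **THE DECOUPLED EXPONENT DOMINATES THE VALUE**: `value ≦ qDec h` for every integrated field `h` (per annulus and
component `annulusQ_ge`, then `formZ_rescale`). [cite: Balaban1982Higgs2, (3.28) p.589, dictionary at Ã^ε = 0] -/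
theorem value_le_qDec (i : CMulti d L a m2) (hL : 1 < L) (ha : 0 < a) (hm : 0 ≤ m2) (h : i.Inner) :
    i.value ≤ i.qDec h := by
  unfold value qDec
  have hLr : (1 : ℝ) < (L : ℝ) := by exact_mod_cast hL
  refine add_le_add le_rfl (Finset.sum_le_sum fun k hk => ?_)
  have hk1 : 1 ≤ k := (Finset.mem_Icc.mp hk).1
  have hn : 1 ≤ L ^ k := Nat.one_le_pow _ _ (by omega)
  have hak : 0 < B1.aSeq a L k := B1.aSeq_pos ha hLr hk1
  have hs : 0 < i.s k := i.s_pos hL k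
  rw [show ((L : ℝ) ^ k * i.ε) = i.s k from rfl, formZ_rescale hs, formZ, Finset.mul_sum]
  refine Finset.sum_le_sum fun c _ => ?_
  have := annulusQ_ge hn hak hm hs (i.s_div hL k) (i.Λ k) (fun y => i.φ k y c) (fun x => h k x c)
  push_cast at this ⊢
  exact this

/-- … and equals it at the assembled minimiser. [cite: Balaban1982Higgs2, (3.28) p.589, dictionary at Ã^ε = 0] -/
theorem qDec_hStar (i : CMulti d L a m2) (hL : 1 < L) (ha : 0 < a) (hm : 0 ≤ m2) :
    i.qDec i.hStar = i.value := by
  unfold value qDec hStar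
  have hLr : (1 : ℝ) < (L : ℝ) := by exact_mod_cast hL
  congr 1
  refine Finset.sum_congr rfl fun k hk => ?_
  have hk1 : 1 ≤ k := (Finset.mem_Icc.mp hk).1
  have hn : 1 ≤ L ^ k := Nat.one_le_pow _ _ (by omega)
  have hak : 0 < B1.aSeq a L k := B1.aSeq_pos ha hLr hk1
  have hs : 0 < i.s k := i.s_pos hL k
  rw [show ((L : ℝ) ^ k * i.ε) = i.s k from rfl, formZ_rescale hs, formZ, Finset.mul_sum]
  refine Finset.sum_congr rfl fun c _ => ?_
  have := annulusQ_gStar hn hak hm hs (i.s_div hL k) (i.Λ k) (fun y => i.φ k y c)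
  push_cast at this ⊢
  exact this

/-- the decoupled exponent is bounded below (by the value). [folklore] -/
private theorem bddBelow_qDec (i : CMulti d L a m2) (hL : 1 < L) (ha : 0 < a) (hm : 0 ≤ m2) :
    BddBelow (Set.range i.qDec) := by
  refine ⟨i.value, ?_⟩
  rintro _ ⟨h, rfl⟩
  exact i.value_le_qDec hL ha hm h

/-- **(3.28) AT `Ã^ε = 0`, EVERY TERM IDENTIFIED**: `⟨Φ, Δ′(0)Φ⟩ = Σ_{⟨x,x′⟩⊂Λ₅⁽⁰⁾ᶜ}ε^{d−2}|φ₀(x′)−φ₀(x)|² + Σε^d m²|φ₀|²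
+ Σ_{k=1}^{K} ⟨φ′_k, Δ⁽ᵏ⁾(Bᵏ(Λ_k), 0)φ′_k⟩` — the infimum of the decoupled exponent splits over the pieces and each annulus
infimum is the b04 Schur complement (attained at `hStar`). [cite: Balaban1982Higgs2, (3.28) p.589, case Ã^ε = 0 (variational reading; proof the package's)] -/
theorem formN_eq_value (i : CMulti d L a m2) (hL : 1 < L) (ha : 0 < a) (hm : 0 ≤ m2) :
    i.formN = i.value := by
  unfold formN
  refine le_antisymm ?_ (le_ciInf fun h => i.value_le_qDec hL ha hm h)
  exact (ciInf_le (i.bddBelow_qDec hL ha hm) i.hStar).trans_eq (i.qDec_hStar hL ha hm)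

/-- **(3.27) AT `Ã^ε = 0`**: `⟨Φ, Δ′(0)Φ⟩ ≦ ⟨Φ, Δ(0)Φ⟩` — dropping the nonnegative cross terms lowers the exponent
pointwise, hence its infimum. [cite: Balaban1982Higgs2, (3.27) p.589, case Ã^ε = 0 (variational reading; proof the package's)] -/
theorem formN_le_form (i : CMulti d L a m2) (hL : 1 < L) (ha : 0 < a) (hm : 0 ≤ m2) : i.formN ≤ i.form :=
  ciInf_mono (i.bddBelow_qDec hL ha hm) fun h => i.qDec_le_qFull h

/-- `0 ≤ bond0`. [folklore] -/
private theorem bond0_nonneg (i : CMulti d L a m2) : 0 ≤ i.bond0 := by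
  unfold bond0
  refine mul_nonneg (Real.rpow_nonneg i.hε.le _) (Finset.sum_nonneg fun c _ => mul_nonneg (by norm_num) ?_)
  refine Finset.sum_nonneg fun x _ => Finset.sum_nonneg fun x' _ => ?_
  split_ifs <;> positivity

/-- `0 ≤ mass0` for `m² ≥ 0`. [folklore] -/
private theorem mass0_nonneg (i : CMulti d L a m2) (hm : 0 ≤ m2) : 0 ≤ i.mass0 := by
  unfold mass0
  refine mul_nonneg (pow_nonneg i.hε.le _) (Finset.sum_nonneg fun c _ => mul_nonneg hm ?_)
  exact Finset.sum_nonneg fun x _ => mul_self_nonneg _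

/-! ## §4  The instance data of `B2Prop31ZeroField.ZMulti` discharged; `B2.Prop31Printed` on the concrete family -/

/-- **THE CONCRETE INSTANCE AS A `ZMulti` INSTANCE**, with (3.27) `h327` and (3.28) `h328` now THEOREMS
(`formN_le_form`, `formN_eq_value`). [cite: Balaban1982Higgs2, Prop. 3.1 (3.26)–(3.28) p.589, dictionary at Ã^ε = 0] -/
def toZMulti (hL : 1 < L) (ha : 0 < a) (hm : 0 ≤ m2) (i : CMulti d L a m2) : ZMulti d L a m2 where
  ε := i.ε
  hε := i.hε
  K := i.K
  hK := i.hK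
  Λ := i.Λ
  N := i.N
  φ := i.φ
  bond0 := i.bond0
  mass0 := i.mass0
  hb0 := i.bond0_nonneg
  hm0 := i.mass0_nonneg hm
  form := i.form
  formN := i.formN
  h327 := i.formN_le_form hL ha hm
  h328 := i.formN_eq_value hL ha hm

/-- **(3.26) AT `Ã^ε = 0` FOR EVERY CONCRETE INSTANCE**: `γ₀(Σ_{k=0}^{K} bond_k) + γ₀(Σ_{k=0}^{K} mass_k) ≦ ⟨Φ, Δ(0)Φ⟩`
with `γ₀ = B2Prop31ZeroField.gamma0 d L a m²`, the bond/mass sums the printed ones in the physical fields, `⟨Φ, Δ(0)Φ⟩`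
the variational Schur complement of the concrete exponent (3.23) — no instance hypothesis left.
[cite: Balaban1982Higgs2, Prop. 3.1 (3.26) p.589, case Ã^ε = 0 (constant and proof the package's)] -/
theorem sum326_le_form_model (hL : 1 < L) (ha : 0 < a) (hm : 0 ≤ m2) (i : CMulti d L a m2) :
    gamma0 d L a m2 * (∑ k ∈ range (i.K + 1), (i.toZMulti hL ha hm).bond k)
      + gamma0 d L a m2 * (∑ k ∈ range (i.K + 1), (i.toZMulti hL ha hm).mass k) ≤ i.form :=
  (i.toZMulti hL ha hm).sum326_le_form hL ha hm

end CMulti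

/-- **THE CONCRETE ZERO-FIELD FAMILY OF `B2.P31Setting`** (model constants `L := P.L`, `a := P.a`).
[cite: Balaban1982Higgs2, Prop. 3.1 (3.26) p.589, dictionary at Ã^ε = 0] -/
def concreteFam (P : B2.Params) (hL : 1 < P.L) (ha : 0 < P.a) (d : ℕ) {m2 : ℝ} (hm : 0 ≤ m2)
    (i : CMulti d P.L P.a m2) : B2.P31Setting :=
  zeroP31Fam P d m2 (i.toZMulti hL ha hm)

/-- **THE CELL'S TYPED PROPOSITION 3.1 `B2.Prop31Printed P` ON THE CONCRETE ZERO-FIELD FAMILY** — every instance a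
concrete multiscale zero-field configuration with `⟨Φ, Δ(0)Φ⟩` the variational Schur complement of the exponent (3.23);
(3.27)/(3.28) proved, (3.29)₀ from `B2Prop31ZeroField.formZ_ge`; both conjuncts, error constant `C = 0`.
[cite: Balaban1982Higgs2, Prop. 3.1 (3.26) p.589, case Ã^ε = 0 (constant and proof the package's)] -/
theorem prop31Printed_zeroField_model (P : B2.Params) (hL : 1 < P.L) (ha : 0 < P.a) (d : ℕ) {m2 : ℝ}
    (hm : 0 ≤ m2) : B2.Prop31Printed P (concreteFam P hL ha d hm) := by
  obtain ⟨γ₀, C, hγ, hC, h1, h2⟩ := prop31Printed_zeroField P hL ha d hm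
  exact ⟨γ₀, C, hγ, hC, fun i => h1 (i.toZMulti hL ha hm), fun i => h2 (i.toZMulti hL ha hm)⟩

end Literature.MathematicalPhysics.QuantumFieldTheory.Balaban1983to89.B2Prop31ZeroFieldModel

end
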